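import Summits.QuantumFields.YangMills.Theorems.FluctuationComparisonRegPrIntLS2BetaWhitneyHatLiftCurvatureRelativePlaq
import Summits.QuantumFields.YangMills.Theorems.FluctuationComparisonRegPrIntLS2BetaKappaRatioTower
import Summits.QuantumFields.YangMills.Theorems.FluctuationComparisonRegPrIntLS2BetaLogChordComparison
import HarnessLib

/-!
# S2β · THE SUP CHAIN ∕ (D-stage): THE LIFT-CURVATURE COLUMN `ρA` OF THE ρ̃ LETTER AT THE TOWER, IN TEXT CURRENCY — the relative plaquettes of the two hat lifts at a
# child level are bounded in `ℓ²` by the PARENT level's raw relative plaquettes (`L⁻⁴·L^d`, c₁'s CELL-MASS object) and raw relative chords (`σ²`-small, `E`-class)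

Cell `ym3-torus` (rung R3 = continuum `SU(2)` Yang–Mills on T³ at fixed lattice data — NOT d = 4, NOT infinite volume, NOT a mass gap, NOT Clay).  Width seat «width 12»
`ym3-torus-px12` (gen 26), FREE px helper on crux `stmt-QuantumFields-20520`; `--supports` helper, count-neutral, DEFINITION-FREE (0 `def`∕`instance`∕`notation`∕`sorry`,
default heartbeats).

WHY (architect px17 g22 22:05:54Z∕22:10:33Z: px21 g25's (α) `hX′` assembler carries the ρ̃ column; ✓p836058 FILE P splits `discRow'`'s `hρ` into the region columns
{`ρS` (CELL-MASS), `ρA` (relative LIFT plaquettes — «holder: px12»), `mA`}; this is the `ρA` column's analytic input).  At the tower, child height `s = K−(J+(t+1))`,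
parent `s+1`: the two hat lifts are `A_W = lift s (g_{s+1} • Ū^{s+1}(e^ζU₀))`, `A_U = lift s (g₀_{s+1} • Ū^{s+1} U₁)` (P's spelling VERBATIM).  My g24 ✓`…WhitneyHatLiftCurvatureRelativePlaq.
sum_plaq_dist1_rel_lift_sq_le` gives, for ANY two coarse fields with arcs `≤ σ ≤ ¼` and their hat lifts, `Σ_q dist1((P_{A_U} q)⁻¹·P_{A_W} q)² ≤ (L⁻¹)⁴·L^d·(4·Σ_p dist1((P_{X′} p)⁻¹·P_X p)²
+ 768(d−1)(σ+σ)²·Σ_e ‖log X e − log X′ e‖²)`; HERE it is instantiated at the tower and both parent terms are moved to the UNGAUGED TEXT currency of the station ∕ the c₁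
core: the gauged parent pair is COMMONLY gauged (`g₀_{s+1} • Ū^{s+1}U₁ = g_{s+1} • Ū^{s+1}U₀`, px16 ✓`stage_eq_gaugeAct_iter` from (T3)×2 + the bottom relation), so the parent
relative plaquettes are px10's (DOM) integrand `dist1((P_{Ū^{s+1}U₀} p)⁻¹·P_{Ū^{s+1}(e^ζU₀)} p)` (✓`dist1_relPlaq_gaugeAct`), and the log differences are `≤ (1+σ²∕3)·dist1` of the RAW
relative chords `Ū^{s+1}(e^ζU₀) e·(Ū^{s+1}U₀ e)⁻¹` ((L♭) ✓`norm_logVec_sub_le_mul_dist1` + ✓`dist1_gaugeAct_chord'`); the child side is flipped to P's orientation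
`dist1 (P_{A_W} q·(P_{A_U} q)⁻¹)` (lit ✓`dist1_inv_mul_eq`).  The arcs `σ` at the parent level are a LETTER (✓p836168 Q's decayed profile, or ✓p835602 N's `¼`).

WHAT IS PROVED (sorry-free).  ★★★`sum_plaq_relLift_sq_le_tower` (below).  The (α) assembler sums `ρA(t,B)² ≤ Σ_{q ∈ region} (…)²` over `B` with its cover count against
this global `ℓ²` bound.

HONEST SCOPE.  Instantiation + gauge∕orientation moves of landed lemmas; arcs, (T3), the bottom relation, hat weights∕lift formula are HYPOTHESES; nothing of Bałaban's
renormalisation-group analysis is asserted or proved ([Balaban1985Variational] (34) p.283; [Balaban1985RegularSpaces] (1.29) p.81; [Balaban1985Averaging] (8)–(9)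
p.19 — printed conventions).  The ρA column's cover∕budget, (α), the knit, GAP♯∘ (`stub_uniformFibreGapOrbit`, registry 3732b7df UNTOUCHED), the five registered
stubs (0∕5), S2β, 20520, 19936, 19200, `YM3TorusSU2` are NOT proved; no registered stub is closed; rung R3 — NOT d = 4, NOT infinite volume, NOT a mass gap, NOT Clay;
the Yang–Mills mass gap is NOT proved.
-/

set_option autoImplicit false

noncomputable section

namespace Summit.QuantumFields.YangMills.Theorems.FluctuationComparisonRegPrIntLS2BetaLiftCurvatureColumnTower

open Finset
open scoped Real
open Literature.MathematicalPhysics.QuantumLattice (su2Quat)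
open Literature.MathematicalPhysics.QuantumFieldTheory.Balaban1983to89
open T4Continuum T3ContinuumYM3Torus T3TiltDescent T3LevelShift BlockAveraging
open B10Eq27TorusAxialLog (rel axialT)
open T4CubeChartGnomonic (SU2)
open T4HaarSU2ExpChart (expPoint)
open T4ExpWindowSmallField (logVec)
open T3UnitLawDensityEML (ℰp)
open B11GaugeGlue (dist1_inv_mul_eq)
open Summit.QuantumFields.YangMills.Theorems.FluctuationComparisonRegPrIntLS2BetaWhitneyHatLiftCurvatureRelativePlaq (sum_plaq_dist1_rel_lift_sq_le)
open Summit.QuantumFields.YangMills.Theorems.FluctuationComparisonRegPrIntLS2BetaKappaRatioTower (stage_eq_gaugeAct_iter)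
open Summit.QuantumFields.YangMills.Theorems.FluctuationComparisonRegPrIntLS2BetaRelativeGaugeCovariance (dist1_relPlaq_gaugeAct dist1_gaugeAct_chord')
open Summit.QuantumFields.YangMills.Theorems.FluctuationComparisonRegPrIntLS2BetaLogChordComparison (norm_logVec_sub_le_mul_dist1)

/-- ★★★ **THE LIFT-CURVATURE COLUMN AT THE TOWER, IN TEXT CURRENCY.**  At child height `s = K−(J+(t+1))` with parent `s+1 ≤ K−J`: for the hat lifts
`A_W = lift s (g_{s+1} • Ū^{s+1}(e^ζU₀))`, `A_U = lift s (g₀_{s+1} • Ū^{s+1}U₁)` (hat weights, lift formula), (T3)×2 at `s+1`, the bottom relation, and parent arcs `≤ σ ≤ ¼`: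
`Σ_{q : Plaq s} dist1 (P_{A_W} q·(P_{A_U} q)⁻¹)² ≤ (L⁻¹)⁴·L^d·(4·Σ_{p : Plaq (s+1)} dist1((P_{Ū^{s+1}U₀} p)⁻¹·P_{Ū^{s+1}(e^ζU₀)} p)² + 768(d−1)(σ+σ)²·(1+σ²∕3)²·Σ_e dist1(Ū^{s+1}(e^ζU₀) e·(Ū^{s+1}U₀ e)⁻¹)²)`.
[cite: Balaban1985Variational, (34) p.283; Balaban1985RegularSpaces, (1.29) p.81; Balaban1985Averaging, (8)-(9) p.19] -/
theorem sum_plaq_relLift_sq_le_tower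
    {F : T3Family} {J K : ℕ} (U₀ : GaugeField (F.P K) 0 (Matrix.specialUnitaryGroup (Fin 2) ℂ)) (ζ : PBond (F.P K) 0 → EuclideanSpace ℝ (Fin 3))
    (wt : (j : ℕ) → PBond (F.P K) j → PBond (F.P K) (j + 1) → ℝ)
    (lift : (j : ℕ) → GaugeField (F.P K) (j + 1) SU2 → GaugeField (F.P K) j SU2)
    (U₁ : GaugeField (F.P K) 0 SU2) (g g₀ : (j : ℕ) → Site (F.P K) j → SU2)
    (hwt : ∀ j b e, wt j b e = if e.dir = b.dir ∧ (b.src b.dir - emb e.src b.dir).val < (F.P K).L then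
        ∏ ν ∈ Finset.univ.erase b.dir, max 0 (1 - ((rel (emb e.src) b.src ν).natAbs : ℝ) / (F.P K).L) else 0)
    (hlift : ∀ j X b, lift j X b = expPoint (∑ e, wt j b e • ((((F.P K).L : ℕ) : ℝ)⁻¹ • logVec (su2Quat (X e)))))
    (hT3 : ∀ X : GaugeField (F.P K) 0 SU2, ∀ j, j ≤ K - J →
      Averaging.iter (fun k => blockAvg (P := F.P K) (j := k) ℰp) j (GaugeField.gaugeAct (g 0) X) =
        GaugeField.gaugeAct (g j) (Averaging.iter (fun k => blockAvg (P := F.P K) (j := k) ℰp) j X))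
    (hT3' : ∀ X : GaugeField (F.P K) 0 SU2, ∀ j, j ≤ K - J →
      Averaging.iter (fun k => blockAvg (P := F.P K) (j := k) ℰp) j (GaugeField.gaugeAct (g₀ 0) X) =
        GaugeField.gaugeAct (g₀ j) (Averaging.iter (fun k => blockAvg (P := F.P K) (j := k) ℰp) j X))
    (hU₀ : U₀ = GaugeField.gaugeAct (fun x => (g 0 x)⁻¹ * g₀ 0 x) U₁)
    (t : ℕ) (ht : t < K - J) {σ : ℝ} (hσ4 : σ ≤ 1 / 4)
    (hσ : ∀ e : PBond (F.P K) ((K - (J + (t + 1))) + 1), ‖logVec (su2Quat (GaugeField.gaugeAct (g ((K - (J + (t + 1))) + 1)) (Averaging.iter (fun k => blockAvg (P := F.P K) (j := k) ℰp) ((K - (J + (t + 1))) + 1) (fun ℓ => expPoint (ζ ℓ) * U₀ ℓ)) e))‖ ≤ σ)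
    (hσ' : ∀ e : PBond (F.P K) ((K - (J + (t + 1))) + 1), ‖logVec (su2Quat (GaugeField.gaugeAct (g₀ ((K - (J + (t + 1))) + 1)) (Averaging.iter (fun k => blockAvg (P := F.P K) (j := k) ℰp) ((K - (J + (t + 1))) + 1) U₁) e))‖ ≤ σ) :
    ∑ q : Plaq (F.P K) (K - (J + (t + 1))),
        dist1 (GaugeField.plaqHol (lift (K - (J + (t + 1))) (GaugeField.gaugeAct (g ((K - (J + (t + 1))) + 1)) (Averaging.iter (fun k => blockAvg (P := F.P K) (j := k) ℰp) ((K - (J + (t + 1))) + 1) (fun ℓ => expPoint (ζ ℓ) * U₀ ℓ)))) q * (GaugeField.plaqHol (lift (K - (J + (t + 1))) (GaugeField.gaugeAct (g₀ ((K - (J + (t + 1))) + 1)) (Averaging.iter (fun k => blockAvg (P := F.P K) (j := k) ℰp) ((K - (J + (t + 1))) + 1) U₁))) q)⁻¹) ^ 2 ≤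
      (((((F.P K).L : ℕ) : ℝ)⁻¹) ^ 2) ^ 2 * (((F.P K).L : ℕ) : ℝ) ^ (F.P K).d *
        (4 * ∑ p : Plaq (F.P K) ((K - (J + (t + 1))) + 1),
            dist1 ((GaugeField.plaqHol (Averaging.iter (fun k => blockAvg (P := F.P K) (j := k) ℰp) ((K - (J + (t + 1))) + 1) U₀) p)⁻¹ * GaugeField.plaqHol (Averaging.iter (fun k => blockAvg (P := F.P K) (j := k) ℰp) ((K - (J + (t + 1))) + 1) (fun ℓ => expPoint (ζ ℓ) * U₀ ℓ : GaugeField (F.P K) 0 (Matrix.specialUnitaryGroup (Fin 2) ℂ))) p) ^ 2 +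
          768 * (((F.P K).d : ℝ) - 1) * (σ + σ) ^ 2 * ((1 + σ ^ 2 / 3) ^ 2 *
            ∑ e : PBond (F.P K) ((K - (J + (t + 1))) + 1), dist1 ((Averaging.iter (fun k => blockAvg (P := F.P K) (j := k) ℰp) ((K - (J + (t + 1))) + 1) (fun ℓ => expPoint (ζ ℓ) * U₀ ℓ : GaugeField (F.P K) 0 (Matrix.specialUnitaryGroup (Fin 2) ℂ))) e * ((Averaging.iter (fun k => blockAvg (P := F.P K) (j := k) ℰp) ((K - (J + (t + 1))) + 1) U₀) e)⁻¹) ^ 2)) := by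
  have hsK : ((K - (J + (t + 1))) + 1) ≤ (F.P K).m + (F.P K).K := by show ((K - (J + (t + 1))) + 1) ≤ F.m + K; omega
  have hs1 : ((K - (J + (t + 1))) + 1) ≤ K - J := by omega
  -- the (F3)-rel engine on the gauged parent pair
  have h := sum_plaq_dist1_rel_lift_sq_le (P := F.P K) (t := (K - (J + (t + 1)))) hsK (wt (K - (J + (t + 1)))) (hwt (K - (J + (t + 1))))
    (GaugeField.gaugeAct (g ((K - (J + (t + 1))) + 1)) (Averaging.iter (fun k => blockAvg (P := F.P K) (j := k) ℰp) ((K - (J + (t + 1))) + 1) (fun ℓ => expPoint (ζ ℓ) * U₀ ℓ))) (GaugeField.gaugeAct (g₀ ((K - (J + (t + 1))) + 1)) (Averaging.iter (fun k => blockAvg (P := F.P K) (j := k) ℰp) ((K - (J + (t + 1))) + 1) U₁)) (lift (K - (J + (t + 1))) (GaugeField.gaugeAct (g ((K - (J + (t + 1))) + 1)) (Averaging.iter (fun k => blockAvg (P := F.P K) (j := k) ℰp) ((K - (J + (t + 1))) + 1) (fun ℓ => expPoint (ζ ℓ) * U₀ ℓ)))) (lift (K - (J + (t + 1))) (GaugeField.gaugeAct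 (g₀ ((K - (J + (t + 1))) + 1)) (Averaging.iter (fun k => blockAvg (P := F.P K) (j := k) ℰp) ((K - (J + (t + 1))) + 1) U₁))) (fun b => hlift (K - (J + (t + 1))) _ b) (fun b => hlift (K - (J + (t + 1))) _ b) hσ hσ' hσ4 hσ4
  -- the child side in P's orientation: `dist1 (a⁻¹·b) = dist1 (b·a⁻¹)`
  have hflip : ∀ p : Plaq (F.P K) (K - (J + (t + 1))),
      dist1 ((GaugeField.plaqHol (lift (K - (J + (t + 1))) (GaugeField.gaugeAct (g₀ ((K - (J + (t + 1))) + 1)) (Averaging.iter (fun k => blockAvg (P := F.P K) (j := k) ℰp) ((K - (J + (t + 1))) + 1) U₁))) p)⁻¹ * GaugeField.plaqHol (lift (K - (J + (t + 1))) (GaugeField.gaugeAct (g ((K - (J + (t + 1))) + 1)) (Averaging.iter (fun k => blockAvg (P := F.P K) (j := k) ℰp) ((K - (J + (t + 1))) + 1) (fun ℓ => expPoint (ζ ℓ) * U₀ ℓ)))) p) =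
        dist1 (GaugeField.plaqHol (lift (K - (J + (t + 1))) (GaugeField.gaugeAct (g ((K - (J + (t + 1))) + 1)) (Averaging.iter (fun k => blockAvg (P := F.P K) (j := k) ℰp) ((K - (J + (t + 1))) + 1) (fun ℓ => expPoint (ζ ℓ) * U₀ ℓ)))) p * (GaugeField.plaqHol (lift (K - (J + (t + 1))) (GaugeField.gaugeAct (g₀ ((K - (J + (t + 1))) + 1)) (Averaging.iter (fun k => blockAvg (P := F.P K) (j := k) ℰp) ((K - (J + (t + 1))) + 1) U₁))) p)⁻¹) := by
    intro p
    rw [dist1_inv_mul_eq, show GaugeField.plaqHol (lift (K - (J + (t + 1))) (GaugeField.gaugeAct (g₀ ((K - (J + (t + 1))) + 1)) (Averaging.iter (fun k => blockAvg (P := F.P K) (j := k) ℰp) ((K - (J + (t + 1))) + 1) U₁))) p * (GaugeField.plaqHol (lift (K - (J + (t + 1))) (GaugeField.gaugeAct (g ((K - (J + (t + 1))) + 1)) (Averaging.iter (fun k => blockAvg (P := F.P K) (j := k) ℰp) ((K - (J + (t + 1))) + 1) (fun ℓ => expPoint (ζ ℓ) * U₀ ℓ)))) p)⁻¹ =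
      (GaugeField.plaqHol (lift (K - (J + (t + 1))) (GaugeField.gaugeAct (g ((K - (J + (t + 1))) + 1)) (Averaging.iter (fun k => blockAvg (P := F.P K) (j := k) ℰp) ((K - (J + (t + 1))) + 1) (fun ℓ => expPoint (ζ ℓ) * U₀ ℓ)))) p * (GaugeField.plaqHol (lift (K - (J + (t + 1))) (GaugeField.gaugeAct (g₀ ((K - (J + (t + 1))) + 1)) (Averaging.iter (fun k => blockAvg (P := F.P K) (j := k) ℰp) ((K - (J + (t + 1))) + 1) U₁))) p)⁻¹)⁻¹ by rw [mul_inv_rev, inv_inv], GaugeGroup.dist1_inv]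
  simp only [hflip] at h
  -- the parent pair is COMMONLY gauged: `g₀ • Ū U₁ = g • Ū U₀`
  have hstage : GaugeField.gaugeAct (g₀ ((K - (J + (t + 1))) + 1)) (Averaging.iter (fun k => blockAvg (P := F.P K) (j := k) ℰp) ((K - (J + (t + 1))) + 1) U₁) = GaugeField.gaugeAct (g ((K - (J + (t + 1))) + 1)) (Averaging.iter (fun k => blockAvg (P := F.P K) (j := k) ℰp) ((K - (J + (t + 1))) + 1) U₀) :=
    stage_eq_gaugeAct_iter (fun k => blockAvg (P := F.P K) (j := k) ℰp) g g₀ U₁ U₀ (fun X => hT3 X ((K - (J + (t + 1))) + 1) hs1) (fun X => hT3' X ((K - (J + (t + 1))) + 1) hs1) hU₀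
  -- the parent relative plaquettes in TEXT currency
  have hP : ∑ p : Plaq (F.P K) ((K - (J + (t + 1))) + 1), dist1 ((GaugeField.plaqHol (GaugeField.gaugeAct (g₀ ((K - (J + (t + 1))) + 1)) (Averaging.iter (fun k => blockAvg (P := F.P K) (j := k) ℰp) ((K - (J + (t + 1))) + 1) U₁)) p)⁻¹ * GaugeField.plaqHol (GaugeField.gaugeAct (g ((K - (J + (t + 1))) + 1)) (Averaging.iter (fun k => blockAvg (P := F.P K) (j := k) ℰp) ((K - (J + (t + 1))) + 1) (fun ℓ => expPoint (ζ ℓ) * U₀ ℓ))) p) ^ 2 =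
      ∑ p : Plaq (F.P K) ((K - (J + (t + 1))) + 1), dist1 ((GaugeField.plaqHol (Averaging.iter (fun k => blockAvg (P := F.P K) (j := k) ℰp) ((K - (J + (t + 1))) + 1) U₀) p)⁻¹ * GaugeField.plaqHol (Averaging.iter (fun k => blockAvg (P := F.P K) (j := k) ℰp) ((K - (J + (t + 1))) + 1) (fun ℓ => expPoint (ζ ℓ) * U₀ ℓ : GaugeField (F.P K) 0 (Matrix.specialUnitaryGroup (Fin 2) ℂ))) p) ^ 2 := by
    rw [hstage]
    exact Finset.sum_congr rfl fun p _ => by rw [dist1_relPlaq_gaugeAct]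
  -- the parent log differences against the RAW relative chords ((L♭) + common gauge)
  have hσ0 : 0 ≤ σ := (norm_nonneg _).trans (hσ ⟨default, ⟨0, (F.P K).hd⟩⟩)
  have hσ3 : σ ^ 2 ≤ 3 := by nlinarith
  have hE : ∑ e : PBond (F.P K) ((K - (J + (t + 1))) + 1), ‖logVec (su2Quat (GaugeField.gaugeAct (g ((K - (J + (t + 1))) + 1)) (Averaging.iter (fun k => blockAvg (P := F.P K) (j := k) ℰp) ((K - (J + (t + 1))) + 1) (fun ℓ => expPoint (ζ ℓ) * U₀ ℓ)) e)) - logVec (su2Quat (GaugeField.gaugeAct (g₀ ((K - (J + (t + 1))) + 1)) (Averaging.iter (fun k => blockAvg (P := F.P K) (j := k) ℰp) ((K - (J + (t + 1))) + 1) U₁) e))‖ ^ 2 ≤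
      (1 + σ ^ 2 / 3) ^ 2 * ∑ e : PBond (F.P K) ((K - (J + (t + 1))) + 1), dist1 ((Averaging.iter (fun k => blockAvg (P := F.P K) (j := k) ℰp) ((K - (J + (t + 1))) + 1) (fun ℓ => expPoint (ζ ℓ) * U₀ ℓ : GaugeField (F.P K) 0 (Matrix.specialUnitaryGroup (Fin 2) ℂ))) e * ((Averaging.iter (fun k => blockAvg (P := F.P K) (j := k) ℰp) ((K - (J + (t + 1))) + 1) U₀) e)⁻¹) ^ 2 := by
    rw [Finset.mul_sum]
    refine Finset.sum_le_sum fun e _ => ?_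
    have h1 := norm_logVec_sub_le_mul_dist1 (GaugeField.gaugeAct (g ((K - (J + (t + 1))) + 1)) (Averaging.iter (fun k => blockAvg (P := F.P K) (j := k) ℰp) ((K - (J + (t + 1))) + 1) (fun ℓ => expPoint (ζ ℓ) * U₀ ℓ)) e) (GaugeField.gaugeAct (g₀ ((K - (J + (t + 1))) + 1)) (Averaging.iter (fun k => blockAvg (P := F.P K) (j := k) ℰp) ((K - (J + (t + 1))) + 1) U₁) e) (hσ e) (hσ' e) hσ3
    have h2 : dist1 (GaugeField.gaugeAct (g ((K - (J + (t + 1))) + 1)) (Averaging.iter (fun k => blockAvg (P := F.P K) (j := k) ℰp) ((K - (J + (t + 1))) + 1) (fun ℓ => expPoint (ζ ℓ) * U₀ ℓ)) e * (GaugeField.gaugeAct (g₀ ((K - (J + (t + 1))) + 1)) (Averaging.iter (fun k => blockAvg (P := F.P K) (j := k) ℰp) ((K - (J + (t + 1))) + 1) U₁) e)⁻¹) = dist1 ((Averaging.iter (fun k => blockAvg (P := F.P K) (j := k) ℰp) ((K - (J + (t + 1))) + 1) (fun ℓ => expPoint (ζ ℓ) * U₀ ℓ : GaugeField (F.P K)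 0 (Matrix.specialUnitaryGroup (Fin 2) ℂ))) e * ((Averaging.iter (fun k => blockAvg (P := F.P K) (j := k) ℰp) ((K - (J + (t + 1))) + 1) U₀) e)⁻¹) := by
      rw [hstage, dist1_gaugeAct_chord']
    rw [h2] at h1
    rw [← mul_pow]
    exact pow_le_pow_left₀ (norm_nonneg _) h1 2
  -- assemble with nonneg coefficients
  have hc0 : 0 ≤ (((((F.P K).L : ℕ) : ℝ)⁻¹) ^ 2) ^ 2 * (((F.P K).L : ℕ) : ℝ) ^ (F.P K).d :=
    mul_nonneg (pow_nonneg (pow_nonneg (inv_nonneg.mpr (Nat.cast_nonneg _)) 2) 2) (pow_nonneg (Nat.cast_nonneg _) _)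
  have hd1 : 0 ≤ 768 * (((F.P K).d : ℝ) - 1) * (σ + σ) ^ 2 := by
    have h1d : (1 : ℝ) ≤ ((F.P K).d : ℝ) := by exact_mod_cast (F.P K).hd
    have h0d : 0 ≤ ((F.P K).d : ℝ) - 1 := by linarith only [h1d]
    exact mul_nonneg (mul_nonneg (by norm_num) h0d) (sq_nonneg _)
  refine h.trans (mul_le_mul_of_nonneg_left ?_ hc0)
  rw [hP]
  exact add_le_add le_rfl (by have := mul_le_mul_of_nonneg_left hE hd1; linarith only [this])

end Summit.QuantumFields.YangMills.Theorems.FluctuationComparisonRegPrIntLS2BetaLiftCurvatureColumnTower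

end
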